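import Literature.AlgebraicGeometry.HodgeTheory.TwistJetPullback
import HarnessLib

/-!
# The base-change morphism of the twisted jet modules is natural in the module

Layer `Literature/AlgebraicGeometry/HodgeTheory`; sequel to `TwistJetPullback.lean` (`twistJetPullbackHom g hE j : g^* Pʲ(E) ⟶ Pʲ(g^*E)`,
the base-change morphism of the `Ωʲ`-twisted jet modules along a morphism `g : X₀ ⟶ X₁` of `S`-schemes, and its transpose
`twistJetPullbackTransposeHom`; `β_j = twistHodgePullbackTransposeHom`, the transpose of `α_j : g^*(E ⊗ Ωʲ) ⟶ g^*E ⊗ Ωʲ`). For a morphism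
`φ : E₁ ⟶ E₂` of finite locally free `𝒪_{X₁}`-modules:

* `twistMap_comp_twistHodgePullbackTransposeHom` — `(φ ⊗ 1) ≫ β_j(E₂) = β_j(E₁) ≫ g_*(g^*φ ⊗ 1)` (the transpose of the naturality of
  `α_j`, `twistHodgePullbackHom_naturality`), and its sections form `twistHodgePullbackTransposeOver_twistMap_app`;
* `twistJetMap_comp_twistJetPullbackTransposeHom` — `Pʲ(φ) ≫ (Pʲ(E₂) → g_*Pʲ(g^*E₂)) = (Pʲ(E₁) → g_*Pʲ(g^*E₁)) ≫ g_*Pʲ(g^*φ)`;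
* **`pullback_map_twistJetMap_comp_twistJetPullbackHom`** — `g^*(Pʲ(φ)) ≫ (g^*Pʲ(E₂) → Pʲ(g^*E₂)) = (g^*Pʲ(E₁) → Pʲ(g^*E₁)) ≫ Pʲ(g^*φ)`:
  the jet comparison is NATURAL in `E` (so that, applied termwise to a complex `K•` of finite locally free modules, it is a chain map).

Everything is proved; no named facts, no new notion. Motivation: step (Q4) of the typing plan of the library item (L2) `SigmaPullbackCompat`
(crux stmt-HodgeConjecture-26512, support line «sigma-descent-along-q»); nothing of that crux is asserted here.

## References

* M. F. Atiyah, *Complex analytic connections in fibre bundles*, Trans. AMS 85 (1957), §4 Prop. 6–7 (functoriality of the jet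
  extension). [Atiyah1957]
* R.-O. Buchweitz, H. Flenner, Compositio Math. 137 (2003), §3 (Atiyah class; base change). [BuchweitzFlenner2003]
* R. Hartshorne, *Algebraic Geometry* (1977), II §5 p. 110 (`f^* ⊣ f_*`). [Hartshorne1977]
-/

noncomputable section

-- `TopCat.Presheaf`/`Scheme.Modules` are not reducible (as in Mathlib's `AlgebraicGeometry/Modules/Sheaf.lean`).
set_option backward.isDefEq.respectTransparency false

open CategoryTheory CategoryTheory.Limits AlgebraicGeometry Opposite TopologicalSpace
open AlgebraicGeometry.Scheme.Modules

universe u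

namespace Literature.AlgebraicGeometry.HodgeTheory

open Literature.AlgebraicGeometry.Modules Literature.AlgebraicGeometry.Motives

variable {S : Type u} [CommRing S] {X₀ X₁ : Over (Spec (CommRingCat.of S))} (g : X₀ ⟶ X₁)
  {E₁ E₂ : X₁.left.Modules} (φ : E₁ ⟶ E₂) (hE₁ : IsFiniteLocallyFree E₁) (hE₂ : IsFiniteLocallyFree E₂) (j : ℕ)

/-- **Naturality of `β_j` in `E`** (transposed naturality of `α_j`): `(φ ⊗ 1) ≫ β_j(E₂) = β_j(E₁) ≫ g_*(g^*φ ⊗ 1)`.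
[cite: BuchweitzFlenner2003, §3 (base change of E ⊗ Ω)] [cite: Hartshorne1977, II §5 p. 110] -/
theorem twistMap_comp_twistHodgePullbackTransposeHom :
    twistMap φ (hodgeSheaf X₁ j) ≫ twistHodgePullbackTransposeHom g hE₂ j =
      twistHodgePullbackTransposeHom g hE₁ j ≫
        (pushforward g.left).map (twistMap ((Scheme.Modules.pullback g.left).map φ) (hodgeSheaf X₀ j)) := by
  rw [← homEquiv_twistHodgePullbackHom, ← homEquiv_twistHodgePullbackHom, ← Adjunction.homEquiv_naturality_left,
    ← Adjunction.homEquiv_naturality_right, twistHodgePullbackHom_naturality]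

/-- Sections form: `β_j((φ ⊗ 1) ψ) = (g^*φ ⊗ 1)(β_j ψ)` as local morphisms over `g⁻¹V`.
[cite: BuchweitzFlenner2003, §3 (base change of E ⊗ Ω)] -/
theorem twistHodgePullbackTransposeOver_twistMap_app (V : X₁.left.Opens) (ψ : (dual E₁).over V ⟶ (hodgeSheaf X₁ j).over V) :
    twistHodgePullbackTransposeOver g hE₂ j V ((twistMap φ (hodgeSheaf X₁ j)).app V ψ) =
      (twistMap ((Scheme.Modules.pullback g.left).map φ) (hodgeSheaf X₀ j)).app (g.left ⁻¹ᵁ V)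
        (twistHodgePullbackTransposeOver g hE₁ j V ψ) := by
  have h := congrArg (fun θ : twistHodge E₁ j ⟶
      (pushforward g.left).obj (twistHodge ((Scheme.Modules.pullback g.left).obj E₂) j) => Scheme.Modules.Hom.app θ V ψ)
    (twistMap_comp_twistHodgePullbackTransposeHom g φ hE₁ hE₂ j)
  simp only [Scheme.Modules.Hom.comp_app, ConcreteCategory.comp_apply, pushforward_map_app,
    twistHodgePullbackTransposeHom_app] at h
  exact h

/-- **Naturality of `Pʲ(E) ⟶ g_* Pʲ(g^*E)` in `E`**: `Pʲ(φ) ≫ (…)_{E₂} = (…)_{E₁} ≫ g_*Pʲ(g^*φ)` (componentwise the previous lemma).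
[cite: Atiyah1957, §4 Prop. 6–7 (functoriality of the jet extension)] -/
theorem twistJetMap_comp_twistJetPullbackTransposeHom :
    twistJetMap φ j ≫ twistJetPullbackTransposeHom g hE₂ j =
      twistJetPullbackTransposeHom g hE₁ j ≫
        (pushforward g.left).map (twistJetMap ((Scheme.Modules.pullback g.left).map φ) j) := by
  refine Scheme.Modules.hom_ext _ _ fun V => AddCommGrpCat.ext fun (p : TwistJetSections E₁ j V) => ?_
  exact TwistJetSections.ext (twistHodgePullbackTransposeOver_twistMap_app g φ hE₁ hE₂ j V p.fst)
    (twistHodgePullbackTransposeOver_twistMap_app g φ hE₁ hE₂ (j + 1) V p.snd)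

/-- **The base-change morphism of the twisted jet modules is natural in `E`**:
`g^*(Pʲ(φ)) ≫ (g^*Pʲ(E₂) ⟶ Pʲ(g^*E₂)) = (g^*Pʲ(E₁) ⟶ Pʲ(g^*E₁)) ≫ Pʲ(g^*φ)`.
[cite: Atiyah1957, §4 Prop. 6–7 (functoriality of the jet extension)] [cite: BuchweitzFlenner2003, §3 (Atiyah class; base change)] -/
theorem pullback_map_twistJetMap_comp_twistJetPullbackHom :
    (Scheme.Modules.pullback g.left).map (twistJetMap φ j) ≫ twistJetPullbackHom g hE₂ j =
      twistJetPullbackHom g hE₁ j ≫ twistJetMap ((Scheme.Modules.pullback g.left).map φ) j := by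
  apply ((pullbackPushforwardAdjunction g.left).homEquiv _ _).injective
  rw [Adjunction.homEquiv_naturality_left, Adjunction.homEquiv_naturality_right, homEquiv_twistJetPullbackHom,
    homEquiv_twistJetPullbackHom, twistJetMap_comp_twistJetPullbackTransposeHom]

end Literature.AlgebraicGeometry.HodgeTheory

end
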